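import Mathlib
import HarnessLib.Audit
import Summits.PneNP.PneNP.Theorems.PstarChordReadCoupledSplit
import Summits.PneNP.PneNP.Theorems.PstarChordReadCoupled
import Summits.PneNP.PneNP.Theorems.PstarChordReadSharedTypes
import Summits.PneNP.PneNP.Theorems.PstarChordReadTwoGates

/-!
# Two chords whose private switches are coupled by one monomial kill a terminal core (ROUND-24, O1 at exact tightness; residual R3-pure assembled)

FRONTIER range-avoidance ladder, rung F-N3, ROUND 24 (cell `pnp-ideate`, prover-2 memo `g20/O1-CHORD-READ-g20.md` §13.10–§13.11 (residual R3, pure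
coupling); typed target `PstarCoreBoundTargets.TerminalPeelable` (p646951); restricted-model proof complexity — nothing here bears on `P` versus `NP`).

THE R3-PURE CAPSTONE `false_of_two_coupledGates`: chords `cᵢ, cⱼ` read through private gates `gᵢ = (pᵢ, zᵢ)`, `gⱼ = (pⱼ, zⱼ)` whose outside
partners are COUPLED by one monomial `h = (zᵢ, zⱼ)` (`zᵢ`'s monomials ⊆ `{gᵢ, h}`, `zⱼ`'s ⊆ `{gⱼ, h}`, nothing else on the pairs) do not occur in a
terminal core, given `SliceGeneric` at both, `DoubleSliceGeneric` at the pair and a third output.  Split `Γ_k = Γ_k⁰ ⊕ Q_k`; (T3) at the four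
values of `(zᵢ, zⱼ)` says `Γ⁰ ⊕ b ∉ Im Q`; `four_flip`: uniform coefficients or PINNED base pair; pinned ⟹ both `Γ_k⁰` miss a value on the pattern
⟹ bi-chord-local ⟹ `false_of_biLocal₂`; uniform on all patterns ⟹ `uniform_type` ⟹ the coupled type I / II / III kill with the other switch as
the togglable partner.  So RANK ONE's failure on coupled pairs is compensated by the pinning dichotomy.
No Assumption A.
-/

set_option linter.dupNamespace false -- `Summit.PneNP.PneNP.…`: summit = sub-problem name (D-0017 single-conjunct layout)

open Finset Literature.Computability.Complexity
open scoped symmDiff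
open Summit.PneNP.PneNP.Theorems.PstarTyped (Typed)
open Summit.PneNP.PneNP.Theorems.PstarSALevel (varSet bdry BoundaryExpanding SimpleOverlap)
open Summit.PneNP.PneNP.Theorems.PstarGapPeeling (not_mem_varSet_of_private)
open Summit.PneNP.PneNP.Theorems.PstarCentreFree (vars_mem_varSet)
open Summit.PneNP.PneNP.Theorems.PstarGapOneAll (gval)
open Summit.PneNP.PneNP.Theorems.PstarGConstraint (gval_update_of_forall_ne)
open Summit.PneNP.PneNP.Theorems.PstarChordRepair (IsChord)
open Summit.PneNP.PneNP.Theorems.PstarCoreBoundTargets (Terminal)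
open Summit.PneNP.PneNP.Theorems.PstarChordReadsMirror (gval_eq_split)
open Summit.PneNP.PneNP.Theorems.PstarChordReadLemma (SliceGeneric)
open Summit.PneNP.PneNP.Theorems.PstarChordReadSwitch (solves_update_of_outside)
open Summit.PneNP.PneNP.Theorems.PstarChordReadGates (sliceGeneric_mono exists_two_slices)
open Summit.PneNP.PneNP.Theorems.PstarChordReadTwoGates (exists_xor_not_mem_of_simpleOverlap)
open Summit.PneNP.PneNP.Theorems.PstarChordReadSharedTypes (gval_flip_switch₂)
open Summit.PneNP.PneNP.Theorems.PstarChordReadCoupled (false_of_coupled_typeI false_of_coupled_typeII false_of_coupled_typeIII)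
open Summit.PneNP.PneNP.Theorems.PstarChordReadBiLocal (BiChordLocal DoubleSliceGeneric biLocal_of_fail_pattern false_of_biLocal₂)
open Summit.PneNP.PneNP.Theorems.PstarChordReadCoupledSplit

namespace Summit.PneNP.PneNP.Theorems.PstarChordReadCoupledGates

variable {n m : ℕ}

section Main

variable {I : LocalMap 4 n m} {r : ℕ} {y : Fin m → Bool} {J₀ : Finset (Fin m)} {w₁ w₂ : Finset (Fin n) × Finset (Fin m) × Bool}
  {cᵢ cⱼ gᵢ gⱼ h : Fin m} {zᵢ zⱼ : Fin n}

/-- **THE R3-PURE CAPSTONE.  Two slice-generic, double-slice-generic chords read through private gates whose outside partners are coupled by a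
single monomial kill a terminal core — all types.** -/
theorem false_of_two_coupledGates (hI : I.IsPure xorAndPred) (hT : Typed I) (hS : SimpleOverlap I) (hB : BoundaryExpanding r I)
    (ht : Terminal I r y J₀ w₁ w₂) (hcᵢ : cᵢ ∈ J₀) (hcⱼ : cⱼ ∈ J₀) (hne : cᵢ ≠ cⱼ) (hchᵢ : IsChord I J₀ cᵢ) (hchⱼ : IsChord I J₀ cⱼ)
    (hgᵢ : gᵢ ∈ w₁.2.1 ∪ w₂.2.1) (hgⱼ : gⱼ ∈ w₁.2.1 ∪ w₂.2.1) (hh : h ∈ w₁.2.1 ∪ w₂.2.1)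
    (hpairᵢ : (I.vars gᵢ 2 = I.vars cᵢ 2 ∧ I.vars gᵢ 3 = zᵢ) ∨ (I.vars gᵢ 2 = zᵢ ∧ I.vars gᵢ 3 = I.vars cᵢ 2))
    (hpairⱼ : (I.vars gⱼ 2 = I.vars cⱼ 2 ∧ I.vars gⱼ 3 = zⱼ) ∨ (I.vars gⱼ 2 = zⱼ ∧ I.vars gⱼ 3 = I.vars cⱼ 2))
    (hpairh : (I.vars h 2 = zᵢ ∧ I.vars h 3 = zⱼ) ∨ (I.vars h 2 = zⱼ ∧ I.vars h 3 = zᵢ))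
    (hzᵢ : ∀ j ∈ J₀, zᵢ ∉ varSet I j) (hzⱼ : ∀ j ∈ J₀, zⱼ ∉ varSet I j)
    (hotherᵢ : ∀ g ∈ w₁.2.1 ∪ w₂.2.1, g ≠ gᵢ → g ≠ h → I.vars g 2 ≠ zᵢ ∧ I.vars g 3 ≠ zᵢ)
    (hotherⱼ : ∀ g ∈ w₁.2.1 ∪ w₂.2.1, g ≠ gⱼ → g ≠ h → I.vars g 2 ≠ zⱼ ∧ I.vars g 3 ≠ zⱼ)
    (honlyᵢ : ∀ g ∈ w₁.2.1 ∪ w₂.2.1, g ≠ gᵢ →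
      (I.vars g 2 ≠ I.vars cᵢ 2 ∧ I.vars g 3 ≠ I.vars cᵢ 2) ∧ (I.vars g 2 ≠ I.vars cᵢ 3 ∧ I.vars g 3 ≠ I.vars cᵢ 3))
    (honlyⱼ : ∀ g ∈ w₁.2.1 ∪ w₂.2.1, g ≠ gⱼ →
      (I.vars g 2 ≠ I.vars cⱼ 2 ∧ I.vars g 3 ≠ I.vars cⱼ 2) ∧ (I.vars g 2 ≠ I.vars cⱼ 3 ∧ I.vars g 3 ≠ I.vars cⱼ 3))
    (hgenᵢ : SliceGeneric I y J₀ cᵢ (w₁.2.1 ∪ w₂.2.1)) (hgenⱼ : SliceGeneric I y J₀ cⱼ (w₁.2.1 ∪ w₂.2.1))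
    (hgen₂ : DoubleSliceGeneric I y J₀ cᵢ cⱼ (w₁.2.1 ∪ w₂.2.1)) {f : Fin m} (hf : f ∈ J₀) (hfᵢ : f ≠ cᵢ) (hfⱼ : f ≠ cⱼ) : False := by
  classical
  have hv := exists_xor_not_mem_of_simpleOverlap hI hS hne
  have hi23 : I.vars cᵢ 2 ≠ I.vars cᵢ 3 := fun e => absurd (hI.2 cᵢ e) (by decide)
  have hj23 : I.vars cⱼ 2 ≠ I.vars cⱼ 3 := fun e => absurd (hI.2 cⱼ e) (by decide)
  have hpzᵢ : I.vars cᵢ 2 ≠ zᵢ := fun e => hzᵢ cᵢ hcᵢ (e ▸ vars_mem_varSet I cᵢ 2)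
  have hpzⱼ : I.vars cⱼ 2 ≠ zⱼ := fun e => hzⱼ cⱼ hcⱼ (e ▸ vars_mem_varSet I cⱼ 2)
  have hpᵢzⱼ : I.vars cᵢ 2 ≠ zⱼ := fun e => hzⱼ cᵢ hcᵢ (e ▸ vars_mem_varSet I cᵢ 2)
  have hpⱼzᵢ : I.vars cⱼ 2 ≠ zᵢ := fun e => hzᵢ cⱼ hcⱼ (e ▸ vars_mem_varSet I cⱼ 2)
  have hzz : zᵢ ≠ zⱼ := by
    intro e
    rcases hpairh with ⟨h2, h3⟩ | ⟨h2, h3⟩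
    · exact absurd (hI.2 h (h2.trans (e.trans h3.symm))) (by decide)
    · exact absurd (hI.2 h (h2.trans (e.symm.trans h3.symm))) (by decide)
  have hgᵢh : gᵢ ≠ h := by
    intro e; have hp := hpairh; rw [← e] at hp
    rcases hpairᵢ with ⟨a2, -⟩ | ⟨-, a3⟩ <;> rcases hp with ⟨b2, b3⟩ | ⟨b2, b3⟩
    · exact hpzᵢ (a2.symm.trans b2)
    · exact hpᵢzⱼ (a2.symm.trans b2)
    · exact hpᵢzⱼ (a3.symm.trans b3)
    · exact hpzᵢ (a3.symm.trans b3)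
  have hgⱼh : gⱼ ≠ h := by
    intro e; have hp := hpairh; rw [← e] at hp
    rcases hpairⱼ with ⟨a2, -⟩ | ⟨-, a3⟩ <;> rcases hp with ⟨b2, b3⟩ | ⟨b2, b3⟩
    · exact hpⱼzᵢ (a2.symm.trans b2)
    · exact hpzⱼ (a2.symm.trans b2)
    · exact hpzⱼ (a3.symm.trans b3)
    · exact hpⱼzᵢ (a3.symm.trans b3)
  have hgg : gᵢ ≠ gⱼ := by
    intro e
    have hq : I.vars cᵢ 2 ∉ varSet I cⱼ := not_mem_varSet_of_private I hcᵢ hcⱼ hne.symm hchᵢ.1 (vars_mem_varSet I cᵢ 2)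
    have hpp : I.vars cᵢ 2 ≠ I.vars cⱼ 2 := fun e' => hq (e' ▸ vars_mem_varSet I cⱼ 2)
    have hp := hpairⱼ; rw [← e] at hp
    rcases hpairᵢ with ⟨a2, a3⟩ | ⟨a2, a3⟩ <;> rcases hp with ⟨b2, b3⟩ | ⟨b2, b3⟩
    · exact hpp (a2.symm.trans b2)
    · exact hpᵢzⱼ (a2.symm.trans b2)
    · exact hpⱼzᵢ (b2.symm.trans a2)
    · exact hpp (a3.symm.trans b3)
  have hpairh' : (I.vars h 2 = zⱼ ∧ I.vars h 3 = zᵢ) ∨ (I.vars h 2 = zᵢ ∧ I.vars h 3 = zⱼ) := hpairh.symm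
  have flipᵢ : ∀ (C : Finset (Fin n)) (G : Finset (Fin m)), G ⊆ w₁.2.1 ∪ w₂.2.1 → ∀ x : Fin n → Bool,
      gval I C G (Function.update x zᵢ (!x zᵢ)) =
        xor (gval I C G x) (xor (xor (decide (zᵢ ∈ C)) (decide (gᵢ ∈ G) && x (I.vars cᵢ 2))) (decide (h ∈ G) && x zⱼ)) :=
    fun C G hG x => gval_flip_switch₂ I hI hgᵢh hpzᵢ hzz.symm hpairᵢ hpairh' (fun g hg h1 h2 => hotherᵢ g (hG hg) h1 h2) x
  have flipⱼ : ∀ (C : Finset (Fin n)) (G : Finset (Fin m)), G ⊆ w₁.2.1 ∪ w₂.2.1 → ∀ x : Fin n → Bool,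
      gval I C G (Function.update x zⱼ (!x zⱼ)) =
        xor (gval I C G x) (xor (xor (decide (zⱼ ∈ C)) (decide (gⱼ ∈ G) && x (I.vars cⱼ 2))) (decide (h ∈ G) && x zᵢ)) :=
    fun C G hG x => gval_flip_switch₂ I hI hgⱼh hpzⱼ hzz hpairⱼ hpairh (fun g hg h1 h2 => hotherⱼ g (hG hg) h1 h2) x
  -- the base readers and the split `Γ = Γ⁰ ⊕ Q`
  let C₀ : Finset (Fin n) × Finset (Fin m) × Bool → Finset (Fin n) := fun w => (w.1.erase zᵢ).erase zⱼ
  let G₀ : Finset (Fin n) × Finset (Fin m) × Bool → Finset (Fin m) := fun w => ((w.2.1.erase gᵢ).erase gⱼ).erase h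
  let Q : Finset (Fin n) × Finset (Fin m) × Bool → Bool → Bool → Bool → Bool → Bool := fun w a b u v =>
    xor (decide (h ∈ (w.2.1.erase gᵢ).erase gⱼ) && (u && v)) (xor (decide (gⱼ ∈ w.2.1.erase gᵢ) && (b && v))
      (xor (decide (gᵢ ∈ w.2.1) && (a && u)) (xor (decide (zᵢ ∈ w.1) && u) (decide (zⱼ ∈ w.1) && v))))
  have hsplit : ∀ (w : Finset (Fin n) × Finset (Fin m) × Bool) (x : Fin n → Bool),
      gval I w.1 w.2.1 x = xor (gval I (C₀ w) (G₀ w) x) (Q w (x (I.vars cᵢ 2)) (x (I.vars cⱼ 2)) (x zᵢ) (x zⱼ)) := by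
    intro w x
    rw [gval_eq_split I hzz w.1 w.2.1 x, gval_erase_mono I _ w.2.1 gᵢ, gval_erase_mono I _ (w.2.1.erase gᵢ) gⱼ,
      gval_erase_mono I _ ((w.2.1.erase gᵢ).erase gⱼ) h, pair_and hpairᵢ, pair_and hpairⱼ, pair_and hpairh]
    simp only [C₀, G₀, Q, Bool.xor_assoc]
  have hG₀sub : ∀ w : Finset (Fin n) × Finset (Fin m) × Bool, G₀ w ⊆ w.2.1 := fun w =>
    (erase_subset _ _).trans ((erase_subset _ _).trans (erase_subset _ _))
  have hG₀₁ : G₀ w₁ ⊆ w₁.2.1 ∪ w₂.2.1 := (hG₀sub w₁).trans subset_union_left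
  have hG₀₂ : G₀ w₂ ⊆ w₁.2.1 ∪ w₂.2.1 := (hG₀sub w₂).trans subset_union_right
  have memG₀ : ∀ (w : Finset (Fin n) × Finset (Fin m) × Bool) (g : Fin m), g ∈ G₀ w → g ∈ w.2.1 ∧ g ≠ gᵢ ∧ g ≠ gⱼ ∧ g ≠ h := by
    intro w g hg
    exact ⟨mem_of_mem_erase (mem_of_mem_erase (mem_of_mem_erase hg)),
      ne_of_mem_erase (mem_of_mem_erase (mem_of_mem_erase hg)), ne_of_mem_erase (mem_of_mem_erase hg), ne_of_mem_erase hg⟩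
  have base_inv : ∀ (w : Finset (Fin n) × Finset (Fin m) × Bool), w.2.1 ⊆ w₁.2.1 ∪ w₂.2.1 → ∀ (x : Fin n → Bool) (u v : Bool),
      gval I (C₀ w) (G₀ w) (Function.update (Function.update x zᵢ u) zⱼ v) = gval I (C₀ w) (G₀ w) x := by
    intro w hw x u v
    have hzⱼC : zⱼ ∉ C₀ w := notMem_erase _ _
    have hzᵢC : zᵢ ∉ C₀ w := fun hm => notMem_erase _ _ (mem_of_mem_erase hm)
    rw [gval_update_of_forall_ne I _ hzⱼC (fun g hg => hotherⱼ g (hw (memG₀ w g hg).1) (memG₀ w g hg).2.2.1 (memG₀ w g hg).2.2.2),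
      gval_update_of_forall_ne I _ hzᵢC (fun g hg => hotherᵢ g (hw (memG₀ w g hg).1) (memG₀ w g hg).2.1 (memG₀ w g hg).2.2.2)]
  -- (T3) at the four values of `(zᵢ, zⱼ)` over a solution
  have T3four : ∀ x : Fin n → Bool, (∀ j ∈ J₀, I.eval x j = y j) → ∀ u v : Bool,
      ¬ (xor (xor (gval I (C₀ w₁) (G₀ w₁) x) w₁.2.2)
            (quad (xor (decide (zᵢ ∈ w₁.1)) (decide (gᵢ ∈ w₁.2.1) && x (I.vars cᵢ 2)))
              (xor (decide (zⱼ ∈ w₁.1)) (decide (gⱼ ∈ w₁.2.1) && x (I.vars cⱼ 2))) (decide (h ∈ w₁.2.1)) u v) = false ∧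
         xor (xor (gval I (C₀ w₂) (G₀ w₂) x) w₂.2.2)
            (quad (xor (decide (zᵢ ∈ w₂.1)) (decide (gᵢ ∈ w₂.2.1) && x (I.vars cᵢ 2)))
              (xor (decide (zⱼ ∈ w₂.1)) (decide (gⱼ ∈ w₂.2.1) && x (I.vars cⱼ 2))) (decide (h ∈ w₂.2.1)) u v) = false) := by
    intro x hx u v hbad
    have hx' : ∀ j ∈ J₀, I.eval (Function.update (Function.update x zᵢ u) zⱼ v) j = y j :=
      solves_update_of_outside hzⱼ (solves_update_of_outside hzᵢ hx u) v
    have ev : ∀ w : Finset (Fin n) × Finset (Fin m) × Bool, w.2.1 ⊆ w₁.2.1 ∪ w₂.2.1 →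
        gval I w.1 w.2.1 (Function.update (Function.update x zᵢ u) zⱼ v) =
          xor (gval I (C₀ w) (G₀ w) x) (Q w (x (I.vars cᵢ 2)) (x (I.vars cⱼ 2)) u v) := by
      intro w hw
      rw [hsplit w, base_inv w hw, Function.update_of_ne hpᵢzⱼ, Function.update_of_ne hpzᵢ, Function.update_of_ne hpzⱼ,
        Function.update_of_ne hpⱼzᵢ, Function.update_of_ne hzz, Function.update_self, Function.update_self]
    have hmem : ∀ w : Finset (Fin n) × Finset (Fin m) × Bool, decide (gⱼ ∈ w.2.1.erase gᵢ) = decide (gⱼ ∈ w.2.1) ∧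
        decide (h ∈ (w.2.1.erase gᵢ).erase gⱼ) = decide (h ∈ w.2.1) := fun w => by
      constructor
      · by_cases hm : gⱼ ∈ w.2.1
        · rw [decide_eq_true hm, decide_eq_true (mem_erase.2 ⟨hgg.symm, hm⟩)]
        · rw [decide_eq_false hm, decide_eq_false (fun h' => hm (mem_of_mem_erase h'))]
      · by_cases hm : h ∈ w.2.1
        · rw [decide_eq_true hm, decide_eq_true (mem_erase.2 ⟨hgⱼh.symm, mem_erase.2 ⟨hgᵢh.symm, hm⟩⟩)]
        · rw [decide_eq_false hm, decide_eq_false (fun h' => hm (mem_of_mem_erase (mem_of_mem_erase h')))]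
    have hQ : ∀ w : Finset (Fin n) × Finset (Fin m) × Bool, Q w (x (I.vars cᵢ 2)) (x (I.vars cⱼ 2)) u v =
        quad (xor (decide (zᵢ ∈ w.1)) (decide (gᵢ ∈ w.2.1) && x (I.vars cᵢ 2)))
          (xor (decide (zⱼ ∈ w.1)) (decide (gⱼ ∈ w.2.1) && x (I.vars cⱼ 2))) (decide (h ∈ w.2.1)) u v := by
      intro w
      simp only [Q]
      rw [(hmem w).1, (hmem w).2]
      exact Q_eq_quad _ _ _ _ _ _ _ _ _
    refine ht.2.2.2.2.2.2.1 ⟨_, hx', ?_, ?_⟩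
    · rw [ev w₁ subset_union_left, hQ w₁]
      have hb := hbad.1
      revert hb
      generalize quad (xor (decide (zᵢ ∈ w₁.1)) (decide (gᵢ ∈ w₁.2.1) && x (I.vars cᵢ 2)))
        (xor (decide (zⱼ ∈ w₁.1)) (decide (gⱼ ∈ w₁.2.1) && x (I.vars cⱼ 2))) (decide (h ∈ w₁.2.1)) u v = q
      cases gval I (C₀ w₁) (G₀ w₁) x <;> cases w₁.2.2 <;> cases q <;> decide
    · rw [ev w₂ subset_union_right, hQ w₂]
      have hb := hbad.2
      revert hb
      generalize quad (xor (decide (zᵢ ∈ w₂.1)) (decide (gᵢ ∈ w₂.2.1) && x (I.vars cᵢ 2)))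
        (xor (decide (zⱼ ∈ w₂.1)) (decide (gⱼ ∈ w₂.2.1) && x (I.vars cⱼ 2))) (decide (h ∈ w₂.2.1)) u v = q
      cases gval I (C₀ w₂) (G₀ w₂) x <;> cases w₂.2.2 <;> cases q <;> decide
  have hν : (decide (h ∈ w₁.2.1) || decide (h ∈ w₂.2.1)) = true := by rcases mem_union.1 hh with e | e <;> simp [e]
  by_cases Hpin : ∃ s t : Bool, ¬ (((xor (decide (zᵢ ∈ w₁.1)) (decide (gᵢ ∈ w₁.2.1) && s) = false ∧ xor (decide (zᵢ ∈ w₂.1)) (decide (gᵢ ∈ w₂.2.1) && s) = false) ∨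
        (xor (decide (zᵢ ∈ w₁.1)) (decide (gᵢ ∈ w₁.2.1) && s) = decide (h ∈ w₁.2.1) ∧ xor (decide (zᵢ ∈ w₂.1)) (decide (gᵢ ∈ w₂.2.1) && s) = decide (h ∈ w₂.2.1))) ∧
      ((xor (decide (zⱼ ∈ w₁.1)) (decide (gⱼ ∈ w₁.2.1) && t) = false ∧ xor (decide (zⱼ ∈ w₂.1)) (decide (gⱼ ∈ w₂.2.1) && t) = false) ∨
        (xor (decide (zⱼ ∈ w₁.1)) (decide (gⱼ ∈ w₁.2.1) && t) = decide (h ∈ w₁.2.1) ∧ xor (decide (zⱼ ∈ w₂.1)) (decide (gⱼ ∈ w₂.2.1) && t) = decide (h ∈ w₂.2.1))))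
  · -- PINNED: on the pattern `(s, 0, t, 0)` both base readers take a single value
    obtain ⟨s, t, hst⟩ := Hpin
    obtain ⟨x₀, hx₀, e2ᵢ, e3ᵢ, e2ⱼ, e3ⱼ⟩ := exists_two_slices hI hcᵢ hcⱼ hne hchᵢ hchⱼ hv hgenᵢ s false t false
    have pinned : ∀ x : Fin n → Bool, (∀ j ∈ J₀, I.eval x j = y j) → x (I.vars cᵢ 2) = s → x (I.vars cᵢ 3) = false →
        x (I.vars cⱼ 2) = t → x (I.vars cⱼ 3) = false →
        gval I (C₀ w₁) (G₀ w₁) x = gval I (C₀ w₁) (G₀ w₁) x₀ ∧ gval I (C₀ w₂) (G₀ w₂) x = gval I (C₀ w₂) (G₀ w₂) x₀ := by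
      intro x hx hp _ hp' _
      have T := T3four x hx
      have T₀ := T3four x₀ hx₀
      rw [hp, hp'] at T
      rw [e2ᵢ, e2ⱼ] at T₀
      rcases four_flip _ _ _ _ _ _ _ _ _ _ hν T₀ T with huni | ⟨h₁, h₂⟩
      · exact absurd huni hst
      · refine ⟨?_, ?_⟩
        · revert h₁; cases gval I (C₀ w₁) (G₀ w₁) x <;> cases gval I (C₀ w₁) (G₀ w₁) x₀ <;> cases w₁.2.2 <;> decide
        · revert h₂; cases gval I (C₀ w₂) (G₀ w₂) x <;> cases gval I (C₀ w₂) (G₀ w₂) x₀ <;> cases w₂.2.2 <;> decide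
    -- the menu of the base readers avoids both pairs
    have hmono₀ᵢ : ∀ g ∈ G₀ w₁ ∪ G₀ w₂,
        (I.vars g 2 ≠ I.vars cᵢ 2 ∧ I.vars g 3 ≠ I.vars cᵢ 2) ∧ (I.vars g 2 ≠ I.vars cᵢ 3 ∧ I.vars g 3 ≠ I.vars cᵢ 3) := by
      intro g hg
      rcases mem_union.1 hg with hg | hg
      · exact honlyᵢ g (mem_union_left _ (memG₀ w₁ g hg).1) (memG₀ w₁ g hg).2.1
      · exact honlyᵢ g (mem_union_right _ (memG₀ w₂ g hg).1) (memG₀ w₂ g hg).2.1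
    have hmono₀ⱼ : ∀ g ∈ G₀ w₁ ∪ G₀ w₂,
        (I.vars g 2 ≠ I.vars cⱼ 2 ∧ I.vars g 3 ≠ I.vars cⱼ 2) ∧ (I.vars g 2 ≠ I.vars cⱼ 3 ∧ I.vars g 3 ≠ I.vars cⱼ 3) := by
      intro g hg
      rcases mem_union.1 hg with hg | hg
      · exact honlyⱼ g (mem_union_left _ (memG₀ w₁ g hg).1) (memG₀ w₁ g hg).2.2.1
      · exact honlyⱼ g (mem_union_right _ (memG₀ w₂ g hg).1) (memG₀ w₂ g hg).2.2.1
    have hgen₀ : DoubleSliceGeneric I y J₀ cᵢ cⱼ (G₀ w₁ ∪ G₀ w₂) :=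
      doubleSliceGeneric_mono (union_subset_union (hG₀sub w₁) (hG₀sub w₂)) hgen₂
    have hfail₁ : ∀ x : Fin n → Bool, (∀ j ∈ J₀, I.eval x j = y j) → x (I.vars cᵢ 2) = s → x (I.vars cᵢ 3) = false →
        x (I.vars cⱼ 2) = t → x (I.vars cⱼ 3) = false → gval I (C₀ w₁) (G₀ w₁) x ≠ !gval I (C₀ w₁) (G₀ w₁) x₀ := by
      intro x hx hp hq hp' hq' e
      rw [(pinned x hx hp hq hp' hq').1] at e
      revert e; cases gval I (C₀ w₁) (G₀ w₁) x₀ <;> decide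
    have hfail₂ : ∀ x : Fin n → Bool, (∀ j ∈ J₀, I.eval x j = y j) → x (I.vars cᵢ 2) = s → x (I.vars cᵢ 3) = false →
        x (I.vars cⱼ 2) = t → x (I.vars cⱼ 3) = false → gval I (C₀ w₂) (G₀ w₂) x ≠ !gval I (C₀ w₂) (G₀ w₂) x₀ := by
      intro x hx hp hq hp' hq' e
      rw [(pinned x hx hp hq hp' hq').2] at e
      revert e; cases gval I (C₀ w₂) (G₀ w₂) x₀ <;> decide
    have hbi₁ : BiChordLocal I J₀ cᵢ cⱼ (C₀ w₁) (G₀ w₁) :=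
      biLocal_of_fail_pattern hI hcᵢ hcⱼ hne hchᵢ hchⱼ hgen₀ hmono₀ᵢ hmono₀ⱼ subset_union_left s false t false _ hfail₁
    have hbi₂ : BiChordLocal I J₀ cᵢ cⱼ (C₀ w₂) (G₀ w₂) :=
      biLocal_of_fail_pattern hI hcᵢ hcⱼ hne hchᵢ hchⱼ hgen₀ hmono₀ᵢ hmono₀ⱼ subset_union_right s false t false _ hfail₂
    exact false_of_biLocal₂ hI ht hcᵢ hcⱼ hne hchᵢ hchⱼ hv hgenᵢ hf hfᵢ hfⱼ
      (biChordLocal_of_split hzᵢ hzⱼ (Q w₁) (hsplit w₁) hbi₁) (biChordLocal_of_split hzᵢ hzⱼ (Q w₂) (hsplit w₂) hbi₂)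
  · -- UNIFORM: `λᵢ = λⱼ = ν`, `e ∈ {0, ν}`
    push Not at Hpin
    have hlᵢ : (decide (gᵢ ∈ w₁.2.1) || decide (gᵢ ∈ w₂.2.1)) = true := by rcases mem_union.1 hgᵢ with e | e <;> simp [e]
    have hlⱼ : (decide (gⱼ ∈ w₁.2.1) || decide (gⱼ ∈ w₂.2.1)) = true := by rcases mem_union.1 hgⱼ with e | e <;> simp [e]
    obtain ⟨k₁ᵢ, k₂ᵢ, k₁ⱼ, k₂ⱼ, Eᵢ, Eⱼ⟩ := uniform_type _ _ _ _ _ _ _ _ _ _ hν hlᵢ hlⱼ (fun s => (Hpin s false).1) (fun t => (Hpin false t).2)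
    -- helpers: invisibility of a switch to a reader not containing its monomials
    have invᵢ : ∀ {G : Finset (Fin m)}, G ⊆ w₁.2.1 ∪ w₂.2.1 → gᵢ ∉ G → h ∉ G → ∀ g ∈ G, I.vars g 2 ≠ zᵢ ∧ I.vars g 3 ≠ zᵢ :=
      fun hG h1 h2 g hg => hotherᵢ g (hG hg) (fun e => h1 (e ▸ hg)) (fun e => h2 (e ▸ hg))
    have invⱼ : ∀ {G : Finset (Fin m)}, G ⊆ w₁.2.1 ∪ w₂.2.1 → gⱼ ∉ G → h ∉ G → ∀ g ∈ G, I.vars g 2 ≠ zⱼ ∧ I.vars g 3 ≠ zⱼ :=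
      fun hG h1 h2 g hg => hotherⱼ g (hG hg) (fun e => h1 (e ▸ hg)) (fun e => h2 (e ▸ hg))
    have avoidᵢ : ∀ {G : Finset (Fin m)}, G ⊆ w₁.2.1 ∪ w₂.2.1 → gᵢ ∉ G →
        ∀ g ∈ G, (I.vars g 2 ≠ I.vars cᵢ 2 ∧ I.vars g 3 ≠ I.vars cᵢ 2) ∧ (I.vars g 2 ≠ I.vars cᵢ 3 ∧ I.vars g 3 ≠ I.vars cᵢ 3) :=
      fun hG h1 g hg => honlyᵢ g (hG hg) (fun e => h1 (e ▸ hg))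
    have avoidⱼ : ∀ {G : Finset (Fin m)}, G ⊆ w₁.2.1 ∪ w₂.2.1 → gⱼ ∉ G →
        ∀ g ∈ G, (I.vars g 2 ≠ I.vars cⱼ 2 ∧ I.vars g 3 ≠ I.vars cⱼ 2) ∧ (I.vars g 2 ≠ I.vars cⱼ 3 ∧ I.vars g 3 ≠ I.vars cⱼ 3) :=
      fun hG h1 g hg => honlyⱼ g (hG hg) (fun e => h1 (e ▸ hg))
    by_cases hh₁ : h ∈ w₁.2.1 <;> by_cases hh₂ : h ∈ w₂.2.1
    · -- TYPE III: everything in both readers; partner for `zᵢ` is `zⱼ` and conversely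
      have hgᵢ₁ : gᵢ ∈ w₁.2.1 := of_decide_eq_true (k₁ᵢ.trans (decide_eq_true hh₁))
      have hgᵢ₂ : gᵢ ∈ w₂.2.1 := of_decide_eq_true (k₂ᵢ.trans (decide_eq_true hh₂))
      have hgⱼ₁ : gⱼ ∈ w₁.2.1 := of_decide_eq_true (k₁ⱼ.trans (decide_eq_true hh₁))
      have hgⱼ₂ : gⱼ ∈ w₂.2.1 := of_decide_eq_true (k₂ⱼ.trans (decide_eq_true hh₂))
      have ezᵢ : decide (zᵢ ∈ w₁.1) = decide (zᵢ ∈ w₂.1) := by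
        rcases Eᵢ with ⟨a, b⟩ | ⟨a, b⟩
        · rw [a, b]
        · rw [a, b, decide_eq_true hh₁, decide_eq_true hh₂]
      have ezⱼ : decide (zⱼ ∈ w₁.1) = decide (zⱼ ∈ w₂.1) := by
        rcases Eⱼ with ⟨a, b⟩ | ⟨a, b⟩
        · rw [a, b]
        · rw [a, b, decide_eq_true hh₁, decide_eq_true hh₂]
      have nsd : ∀ {g : Fin m}, g ∈ w₁.2.1 → g ∈ w₂.2.1 → g ∉ w₁.2.1 ∆ w₂.2.1 := fun h1 h2 hg => by
        rcases Finset.mem_symmDiff.1 hg with ⟨-, k⟩ | ⟨-, k⟩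
        · exact k h2
        · exact k h1
      have nsdC : ∀ {z : Fin n}, decide (z ∈ w₁.1) = decide (z ∈ w₂.1) → z ∉ w₁.1 ∆ w₂.1 := fun e hz => by
        rcases Finset.mem_symmDiff.1 hz with ⟨h1, h2⟩ | ⟨h2, h1⟩
        · exact h2 (of_decide_eq_true (e ▸ decide_eq_true h1))
        · exact h1 (of_decide_eq_true (e.symm ▸ decide_eq_true h2))
      refine false_of_coupled_typeIII hI hT hS hB ht hcᵢ hcⱼ hne hchᵢ hchⱼ hv
        (avoidᵢ (symmDiff_subset_union_finset _ _) (nsd hgᵢ₁ hgᵢ₂)) (avoidⱼ (symmDiff_subset_union_finset _ _) (nsd hgⱼ₁ hgⱼ₂))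
        (sliceGeneric_mono (symmDiff_subset_union_finset _ _) hgenᵢ) (sliceGeneric_mono (symmDiff_subset_union_finset _ _) hgenⱼ) hzᵢ hzⱼ
        hzⱼ (nsdC ezⱼ) (invⱼ (symmDiff_subset_union_finset _ _) (nsd hgⱼ₁ hgⱼ₂) (nsd hh₁ hh₂))
        hzᵢ (nsdC ezᵢ) (invᵢ (symmDiff_subset_union_finset _ _) (nsd hgᵢ₁ hgᵢ₂) (nsd hh₁ hh₂))
        (fun x hx hq => ?_) (fun x hx hq => ?_)
      · have f₁ := flipᵢ w₁.1 w₁.2.1 subset_union_left x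
        have f₂ := flipᵢ w₂.1 w₂.2.1 subset_union_right x
        have f₁' := flipᵢ w₁.1 w₁.2.1 subset_union_left (Function.update x zⱼ (!x zⱼ))
        have f₂' := flipᵢ w₂.1 w₂.2.1 subset_union_right (Function.update x zⱼ (!x zⱼ))
        rw [Function.update_of_ne hpᵢzⱼ, Function.update_self] at f₁' f₂'
        rw [decide_eq_true hgᵢ₁, decide_eq_true hh₁] at f₁ f₁'
        rw [decide_eq_true hgᵢ₂, decide_eq_true hh₂, ← ezᵢ] at f₂ f₂'
        by_cases hM : xor (xor (decide (zᵢ ∈ w₁.1)) (x (I.vars cᵢ 2))) (x zⱼ) = true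
        · left
          exact ⟨ne_of_move f₁ (by rw [Bool.true_and, Bool.true_and]; exact hM),
            ne_of_move f₂ (by rw [Bool.true_and, Bool.true_and]; exact hM)⟩
        · right
          have hM' : xor (xor (decide (zᵢ ∈ w₁.1)) (x (I.vars cᵢ 2))) (!x zⱼ) = true := by
            revert hM; cases decide (zᵢ ∈ w₁.1) <;> cases x (I.vars cᵢ 2) <;> cases x zⱼ <;> decide
          exact ⟨ne_of_move f₁' (by rw [Bool.true_and, Bool.true_and]; exact hM'),
            ne_of_move f₂' (by rw [Bool.true_and, Bool.true_and]; exact hM')⟩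
      · have f₁ := flipⱼ w₁.1 w₁.2.1 subset_union_left x
        have f₂ := flipⱼ w₂.1 w₂.2.1 subset_union_right x
        have f₁' := flipⱼ w₁.1 w₁.2.1 subset_union_left (Function.update x zᵢ (!x zᵢ))
        have f₂' := flipⱼ w₂.1 w₂.2.1 subset_union_right (Function.update x zᵢ (!x zᵢ))
        rw [Function.update_of_ne hpⱼzᵢ, Function.update_self] at f₁' f₂'
        rw [decide_eq_true hgⱼ₁, decide_eq_true hh₁] at f₁ f₁'
        rw [decide_eq_true hgⱼ₂, decide_eq_true hh₂, ← ezⱼ] at f₂ f₂'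
        by_cases hM : xor (xor (decide (zⱼ ∈ w₁.1)) (x (I.vars cⱼ 2))) (x zᵢ) = true
        · left
          exact ⟨ne_of_move f₁ (by rw [Bool.true_and, Bool.true_and]; exact hM),
            ne_of_move f₂ (by rw [Bool.true_and, Bool.true_and]; exact hM)⟩
        · right
          have hM' : xor (xor (decide (zⱼ ∈ w₁.1)) (x (I.vars cⱼ 2))) (!x zᵢ) = true := by
            revert hM; cases decide (zⱼ ∈ w₁.1) <;> cases x (I.vars cⱼ 2) <;> cases x zᵢ <;> decide
          exact ⟨ne_of_move f₁' (by rw [Bool.true_and, Bool.true_and]; exact hM'),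
            ne_of_move f₂' (by rw [Bool.true_and, Bool.true_and]; exact hM')⟩
    · -- TYPE I: everything in `Γ₁` only
      have hgᵢ₁ : gᵢ ∈ w₁.2.1 := of_decide_eq_true (k₁ᵢ.trans (decide_eq_true hh₁))
      have hgᵢ₂ : gᵢ ∉ w₂.2.1 := fun e => hh₂ (of_decide_eq_true (k₂ᵢ.symm.trans (decide_eq_true e)))
      have hgⱼ₁ : gⱼ ∈ w₁.2.1 := of_decide_eq_true (k₁ⱼ.trans (decide_eq_true hh₁))
      have hgⱼ₂ : gⱼ ∉ w₂.2.1 := fun e => hh₂ (of_decide_eq_true (k₂ⱼ.symm.trans (decide_eq_true e)))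
      have ezᵢ : zᵢ ∉ w₂.1 := by
        rcases Eᵢ with ⟨-, b⟩ | ⟨-, b⟩
        · exact of_decide_eq_false b
        · exact fun e => hh₂ (of_decide_eq_true (b ▸ decide_eq_true e))
      have ezⱼ : zⱼ ∉ w₂.1 := by
        rcases Eⱼ with ⟨-, b⟩ | ⟨-, b⟩
        · exact of_decide_eq_false b
        · exact fun e => hh₂ (of_decide_eq_true (b ▸ decide_eq_true e))
      refine false_of_coupled_typeI hI hT hS hB ht hcᵢ hcⱼ hne hchᵢ hchⱼ hv (avoidᵢ subset_union_right hgᵢ₂)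
        (avoidⱼ subset_union_right hgⱼ₂) (sliceGeneric_mono subset_union_right hgenᵢ) (sliceGeneric_mono subset_union_right hgenⱼ)
        hzᵢ ezᵢ (invᵢ subset_union_right hgᵢ₂ hh₂) hzⱼ ezⱼ (invⱼ subset_union_right hgⱼ₂ hh₂)
        hzⱼ ezⱼ (invⱼ subset_union_right hgⱼ₂ hh₂) hzᵢ ezᵢ (invᵢ subset_union_right hgᵢ₂ hh₂)
        (fun x hx hq => ?_) (fun x hx hq => ?_)
      · have f₁ := flipᵢ w₁.1 w₁.2.1 subset_union_left x
        have f₁' := flipᵢ w₁.1 w₁.2.1 subset_union_left (Function.update x zⱼ (!x zⱼ))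
        rw [Function.update_of_ne hpᵢzⱼ, Function.update_self] at f₁'
        rw [decide_eq_true hgᵢ₁, decide_eq_true hh₁] at f₁ f₁'
        by_cases hM : xor (xor (decide (zᵢ ∈ w₁.1)) (x (I.vars cᵢ 2))) (x zⱼ) = true
        · exact Or.inl (ne_of_move f₁ (by rw [Bool.true_and, Bool.true_and]; exact hM))
        · refine Or.inr (ne_of_move f₁' ?_)
          rw [Bool.true_and, Bool.true_and]
          revert hM; cases decide (zᵢ ∈ w₁.1) <;> cases x (I.vars cᵢ 2) <;> cases x zⱼ <;> decide
      · have f₁ := flipⱼ w₁.1 w₁.2.1 subset_union_left x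
        have f₁' := flipⱼ w₁.1 w₁.2.1 subset_union_left (Function.update x zᵢ (!x zᵢ))
        rw [Function.update_of_ne hpⱼzᵢ, Function.update_self] at f₁'
        rw [decide_eq_true hgⱼ₁, decide_eq_true hh₁] at f₁ f₁'
        by_cases hM : xor (xor (decide (zⱼ ∈ w₁.1)) (x (I.vars cⱼ 2))) (x zᵢ) = true
        · exact Or.inl (ne_of_move f₁ (by rw [Bool.true_and, Bool.true_and]; exact hM))
        · refine Or.inr (ne_of_move f₁' ?_)
          rw [Bool.true_and, Bool.true_and]
          revert hM; cases decide (zⱼ ∈ w₁.1) <;> cases x (I.vars cⱼ 2) <;> cases x zᵢ <;> decide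
    · -- TYPE II: everything in `Γ₂` only
      have hgᵢ₂ : gᵢ ∈ w₂.2.1 := of_decide_eq_true (k₂ᵢ.trans (decide_eq_true hh₂))
      have hgᵢ₁ : gᵢ ∉ w₁.2.1 := fun e => hh₁ (of_decide_eq_true (k₁ᵢ.symm.trans (decide_eq_true e)))
      have hgⱼ₂ : gⱼ ∈ w₂.2.1 := of_decide_eq_true (k₂ⱼ.trans (decide_eq_true hh₂))
      have hgⱼ₁ : gⱼ ∉ w₁.2.1 := fun e => hh₁ (of_decide_eq_true (k₁ⱼ.symm.trans (decide_eq_true e)))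
      have ezᵢ : zᵢ ∉ w₁.1 := by
        rcases Eᵢ with ⟨a, -⟩ | ⟨a, -⟩
        · exact of_decide_eq_false a
        · exact fun e => hh₁ (of_decide_eq_true (a ▸ decide_eq_true e))
      have ezⱼ : zⱼ ∉ w₁.1 := by
        rcases Eⱼ with ⟨a, -⟩ | ⟨a, -⟩
        · exact of_decide_eq_false a
        · exact fun e => hh₁ (of_decide_eq_true (a ▸ decide_eq_true e))
      refine false_of_coupled_typeII hI hT hS hB ht hcᵢ hcⱼ hne hchᵢ hchⱼ hv (avoidᵢ subset_union_left hgᵢ₁)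
        (avoidⱼ subset_union_left hgⱼ₁) (sliceGeneric_mono subset_union_left hgenᵢ) (sliceGeneric_mono subset_union_left hgenⱼ)
        hzᵢ ezᵢ (invᵢ subset_union_left hgᵢ₁ hh₁) hzⱼ ezⱼ (invⱼ subset_union_left hgⱼ₁ hh₁)
        hzⱼ ezⱼ (invⱼ subset_union_left hgⱼ₁ hh₁) hzᵢ ezᵢ (invᵢ subset_union_left hgᵢ₁ hh₁)
        (fun x hx hq => ?_) (fun x hx hq => ?_)
      · have f₂ := flipᵢ w₂.1 w₂.2.1 subset_union_right x
        have f₂' := flipᵢ w₂.1 w₂.2.1 subset_union_right (Function.update x zⱼ (!x zⱼ))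
        rw [Function.update_of_ne hpᵢzⱼ, Function.update_self] at f₂'
        rw [decide_eq_true hgᵢ₂, decide_eq_true hh₂] at f₂ f₂'
        by_cases hM : xor (xor (decide (zᵢ ∈ w₂.1)) (x (I.vars cᵢ 2))) (x zⱼ) = true
        · exact Or.inl (ne_of_move f₂ (by rw [Bool.true_and, Bool.true_and]; exact hM))
        · refine Or.inr (ne_of_move f₂' ?_)
          rw [Bool.true_and, Bool.true_and]
          revert hM; cases decide (zᵢ ∈ w₂.1) <;> cases x (I.vars cᵢ 2) <;> cases x zⱼ <;> decide
      · have f₂ := flipⱼ w₂.1 w₂.2.1 subset_union_right x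
        have f₂' := flipⱼ w₂.1 w₂.2.1 subset_union_right (Function.update x zᵢ (!x zᵢ))
        rw [Function.update_of_ne hpⱼzᵢ, Function.update_self] at f₂'
        rw [decide_eq_true hgⱼ₂, decide_eq_true hh₂] at f₂ f₂'
        by_cases hM : xor (xor (decide (zⱼ ∈ w₂.1)) (x (I.vars cⱼ 2))) (x zᵢ) = true
        · exact Or.inl (ne_of_move f₂ (by rw [Bool.true_and, Bool.true_and]; exact hM))
        · refine Or.inr (ne_of_move f₂' ?_)
          rw [Bool.true_and, Bool.true_and]
          revert hM; cases decide (zⱼ ∈ w₂.1) <;> cases x (I.vars cⱼ 2) <;> cases x zᵢ <;> decide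
    · rcases mem_union.1 hh with e | e
      · exact hh₁ e
      · exact hh₂ e

end Main

end Summit.PneNP.PneNP.Theorems.PstarChordReadCoupledGates
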